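/-
Copyright (c) 2026 the pub-hodgecm-mathlib formalisation cell (harness21).  Prover seat hodgecm-mathlib-A-p19 (g19), topic T5 = P8
«(C♯)hol interior», node Cc (J-plc) brick (i) (desk F0P2-plan (g8) census 2026-08-31T19:11Z).  KERNEL module: THEOREMS ONLY.
-/
import Literature.NumberTheory.Weil1964.ArchUnitaryWeilHalfCompact
import Literature.NumberTheory.Weil1964.ArchFollandDualPairDefinitePlace
import HarnessLib

/-!
# Sign-block compactness of BLOCK-DIAGONAL place components: `archUFormPi g v = kV (a, b)` as soon as `g_{w(v)}` does not mix
# positive and negative sign indices ([Folland1989, Prop. (4.39)]; [KonnoKonno2007, §3.1])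

Topic `NumberTheory/Weil1964`; namespace `Literature.NumberTheory.Weil1964` (§1 in `Literature.RepresentationTheory.KonnoKonno2007.RealDualPair`).
KERNEL ONLY: proved theorems, 0 definitions, 0 records, 0 `sorry`.  Sequel of `ArchUnitaryWeilHalfCompact` §4, which treats the DIAGONAL place
components (`archUFormPi_eq_kV_of_diagonal`, enough for the CENTRAL elements `(t·1_𝕍) ⊕ 1_{−𝕍}` of the doubled group).  The (J-plc) junction of node
Cc of the (C♯)hol interior ([Liu2021, Lem. D.2 (1)] at a DEFINITE place, `F0/P2/T5a-TREE.md` §2b) reads the Weil action of a NON-central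
`u ∈ U(V_w)` at ONE definite complex place `w` through the one-place doubled element `ũ = ((u at w, 1 elsewhere) ⊗ 1_W) ⊕ 1`, whose place
component at `v(w)` is BLOCK-diagonal (`u` on the indices of `𝕍`, `1` on those of `−𝕍`) but not diagonal; since `𝕍_w` is definite, the sign frame
puts all of `𝕍` in one sign block and all of `−𝕍` in the other, so the component never mixes the two sign blocks.  This file supplies exactly that
step, generically:

* §1 (the real unitary group `U(α, β)` of ★ `KonnoKonno2007/RealUnitaryDualPair`) **`UForm.exists_eq_kV_of_toBlocks_eq_zero`**: an element of
  `U(α, β)` whose matrix has vanishing off-diagonal blocks IS `kV (a, b)` with `a`, `b` its diagonal blocks (unitarity of the blocks from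
  `gᴴ diag(1,−1) g = diag(1,−1)`);
* §2 **`exists_archUFormPi_eq_kV_of_sign_separated`**: if the matrix `M = g_{w(v)}` of the place component of `g ∈ U(J)(E ⊗ ℝ)` satisfies
  `M i j = 0` whenever the sign-frame entries `signVec … v i`, `signVec … v j` have different signs, then `archUFormPi g v = kV (a, b)` for some
  unitary `a`, `b` — with the blocks identified: `a`, `b` are the sign-sorted diagonal blocks of `D M D⁻¹` (`D` the adapted scaling), so that
  `det b = det (M|_{Q_v × Q_v})` (`det_snd_of_archUFormPi_eq_kV`, the input of ★ `vac_archWeilSectionS_of_kV`'s `∏_v (det b_v)⁻¹`).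

HONEST SCOPE.  Pure matrix bookkeeping over the tree's sign frames; nothing of [Liu2021] is asserted; HC_CM is NOT proved here or anywhere in the
tree.  The consumer (the one-place doubled element and its `η_t ∕ vac` values) is the next brick of the (J-plc) junction.

## References
* [Folland1989] G. B. Folland, *Harmonic Analysis in Phase Space* (1989), §4.2 Prop. (4.39) (the maximal compact `U(n)` of `Sp` and `μ(k) = det^{-1/2} ⊗ μ₀(k)`).
* [KonnoKonno2007] T. Konno, K. Konno, Kyushu J. Math. 61 (2007), §3.1 (sign frames of real unitary dual pairs).
* [MoeglinVignerasWaldspurger1987] C. Mœglin, M.-F. Vignéras, J.-L. Waldspurger, LNM 1291 (1987), Ch. 1 I.17.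
-/

set_option autoImplicit false

noncomputable section

open scoped Matrix

/-! ## §1 Block-diagonal elements of `U(α, β)` are in the maximal compact `kV (U(α) × U(β))` -/

namespace Literature.RepresentationTheory.KonnoKonno2007.RealDualPair

variable {α β : Type*} [Fintype α] [DecidableEq α] [Fintype β] [DecidableEq β]

/-- `(Aᵀ with entries conjugated) = Aᴴ` — the tree's unitary-group membership (`(g.map σ)ᵀ J g = J`, `σ = conj`) read as a conjugate transpose.
[folklore] -/
private theorem transpose_map_starRingEnd {m k : Type*} (A : Matrix m k ℂ) : (A.map (starRingEnd ℂ))ᵀ = Aᴴ := rfl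

/-- **A BLOCK-DIAGONAL element of `U(α, β)` lies in the maximal compact**: if the matrix of `g ∈ U(α, β)` has vanishing off-diagonal blocks,
then `g = kV (a, b)` with `a = g₁₁ ∈ U(α)`, `b = g₂₂ ∈ U(β)` (from `gᴴ · diag(1_α, −1_β) · g = diag(1_α, −1_β)`: `aᴴ a = 1`, `bᴴ b = 1`).
[cite: Folland1989, §4.2 Prop. (4.39)] [cite: KonnoKonno2007, §3.1] -/
theorem UForm.exists_eq_kV_of_toBlocks_eq_zero (g : UForm α β)
    (h₁₂ : (((g : UForm α β) : GL (α ⊕ β) ℂ) : Matrix (α ⊕ β) (α ⊕ β) ℂ).toBlocks₁₂ = 0)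
    (h₂₁ : (((g : UForm α β) : GL (α ⊕ β) ℂ) : Matrix (α ⊕ β) (α ⊕ β) ℂ).toBlocks₂₁ = 0) :
    ∃ k : Matrix.unitaryGroup α ℂ × Matrix.unitaryGroup β ℂ,
      g = UForm.kV α β k ∧
        (k.1 : Matrix α α ℂ) = (((g : UForm α β) : GL (α ⊕ β) ℂ) : Matrix (α ⊕ β) (α ⊕ β) ℂ).toBlocks₁₁ ∧
          (k.2 : Matrix β β ℂ) = (((g : UForm α β) : GL (α ⊕ β) ℂ) : Matrix (α ⊕ β) (α ⊕ β) ℂ).toBlocks₂₂ := by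
  set M := (((g : UForm α β) : GL (α ⊕ β) ℂ) : Matrix (α ⊕ β) (α ⊕ β) ℂ) with hM
  have hblocks : M = Matrix.fromBlocks M.toBlocks₁₁ 0 0 M.toBlocks₂₂ := by
    conv_lhs => rw [← Matrix.fromBlocks_toBlocks M]
    rw [h₁₂, h₂₁]
  -- the unitarity relation `Mᴴ S M = S`, `S = diag(1, −1)`, in block form
  have hmem : (M.map (starRingEnd ℂ))ᵀ * signForm α β * M = signForm α β := g.2
  rw [transpose_map_starRingEnd, hblocks, Matrix.fromBlocks_conjTranspose, Matrix.fromBlocks_multiply, Matrix.fromBlocks_multiply] at hmem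
  simp only [Matrix.conjTranspose_zero, Matrix.zero_mul, Matrix.mul_zero, add_zero, zero_add, Matrix.mul_one, Matrix.mul_neg,
    Matrix.neg_mul] at hmem
  obtain ⟨h11, -, -, h22⟩ := Matrix.fromBlocks_inj.mp hmem
  rw [neg_inj] at h22
  refine ⟨(⟨M.toBlocks₁₁, Matrix.mem_unitaryGroup_iff'.mpr ?_⟩, ⟨M.toBlocks₂₂, Matrix.mem_unitaryGroup_iff'.mpr ?_⟩), ?_, rfl, rfl⟩
  · rw [Matrix.star_eq_conjTranspose]; exact h11
  · rw [Matrix.star_eq_conjTranspose]; exact h22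
  · apply Subtype.ext
    apply Units.ext
    rw [UForm.coe_kV]
    exact hblocks

end Literature.RepresentationTheory.KonnoKonno2007.RealDualPair

/-! ## §2 Place components that do not mix the sign blocks are sign-block compact -/

namespace Literature.NumberTheory.Weil1964

open Literature.RepresentationTheory.KonnoKonno2007 Literature.RepresentationTheory.KonnoKonno2007.RealDualPair
open Literature.NumberTheory.Automorphic Literature.NumberTheory.Automorphic.UnitaryGroup
open NumberField NumberField.InfinitePlace

variable {F : Type} [Field F] [NumberField F] (E : Type) [Field E] [NumberField E] [Algebra F E] (c : E ≃ₐ[F] E)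
  (N : ℕ) (hc : c ≠ 1)
  (wOf : {v : InfinitePlace F // v.IsReal} → {w : InfinitePlace E // w.IsComplex})
  (hw : ∀ v, c • (wOf v).1 = (wOf v).1) (hover : ∀ v, (wOf v).1.comap (algebraMap F E) = v.1)
  (t₀ : Fin N → F) (ht0 : ∀ j, t₀ j ≠ 0) {T : Matrix (Fin N) (Fin N) F} (hTd : T = Matrix.diagonal t₀)
  {J : Matrix (Fin N) (Fin N) E} (hJ : J = T.map (algebraMap F E)) {δ : E} (hcδ : c δ = -δ) (hδ : δ ≠ 0)

/-- **SIGN-SEPARATED place components are sign-block compact.**  Let `M = g_{w(v)}` be the matrix of the place component of `g ∈ U(J)(E ⊗ ℝ)` at the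
complex place `wOf v`.  If `M i j = 0` whenever the sign-frame entries at `i` and `j` have DIFFERENT signs (`0 < signVec … v i` but not
`0 < signVec … v j`, or conversely), then in the sign frame the component is block-diagonal, hence in the maximal compact:
`archUFormPi g v = kV (a, b)` with `a`, `b` unitary — and `b` is the NEGATIVE-sign block of `D M D⁻¹` (`D` the adapted scaling), so that
`det b = det (M|_{Q_v × Q_v})`.  Generalises ★ `archUFormPi_eq_kV_of_diagonal` (diagonal `M`); at a place where the form is DEFINITE on a summand,
every element block-diagonal for that summand qualifies — the one-place doubled elements of the (J-plc) junction.
[cite: Folland1989, §4.2 Prop. (4.39)] [cite: KonnoKonno2007, §3.1] -/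
theorem exists_archUFormPi_eq_kV_of_sign_separated (g : UnitaryGroup.arch F E c N J) (v : {v : InfinitePlace F // v.IsReal})
    (hsep : ∀ i j : Fin N, 0 < signVec wOf t₀ δ v i → ¬ 0 < signVec wOf t₀ δ v j →
      (((archAt F E c N J (wOf v) (hw v) hc g : archLocal E N J (wOf v)) : GL (Fin N) ℂ) : Matrix (Fin N) (Fin N) ℂ) i j = 0 ∧
        (((archAt F E c N J (wOf v) (hw v) hc g : archLocal E N J (wOf v)) : GL (Fin N) ℂ) : Matrix (Fin N) (Fin N) ℂ) j i = 0) :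
    ∃ k : Matrix.unitaryGroup (PosIdx (signVec wOf t₀ δ v)) ℂ × Matrix.unitaryGroup (NegIdx (signVec wOf t₀ δ v)) ℂ,
      archUFormPi E c N hc wOf hw hover t₀ ht0 hTd hJ hcδ hδ g v = UForm.kV _ _ k ∧
        (k.1 : Matrix (PosIdx (signVec wOf t₀ δ v)) (PosIdx (signVec wOf t₀ δ v)) ℂ) =
          scaleConj (fun p : PosIdx (signVec wOf t₀ δ v) => sqrtAbs (signVec wOf t₀ δ v) p.1)
            ((((archAt F E c N J (wOf v) (hw v) hc g : archLocal E N J (wOf v)) : GL (Fin N) ℂ) : Matrix (Fin N) (Fin N) ℂ).submatrix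
              (fun p : PosIdx (signVec wOf t₀ δ v) => p.1) fun p => p.1) ∧
        (k.2 : Matrix (NegIdx (signVec wOf t₀ δ v)) (NegIdx (signVec wOf t₀ δ v)) ℂ) =
          scaleConj (fun q : NegIdx (signVec wOf t₀ δ v) => sqrtAbs (signVec wOf t₀ δ v) q.1)
            ((((archAt F E c N J (wOf v) (hw v) hc g : archLocal E N J (wOf v)) : GL (Fin N) ℂ) : Matrix (Fin N) (Fin N) ℂ).submatrix
              (fun q : NegIdx (signVec wOf t₀ δ v) => q.1) fun q => q.1) := by
  set M := (((archAt F E c N J (wOf v) (hw v) hc g : archLocal E N J (wOf v)) : GL (Fin N) ℂ) : Matrix (Fin N) (Fin N) ℂ) with hM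
  -- the matrix of the place component in the sign frame
  have hmat : UnitaryBall.mat (archUFormPi E c N hc wOf hw hover t₀ ht0 hTd hJ hcδ hδ g v) =
      Matrix.reindex (signSplit (signVec wOf t₀ δ v)) (signSplit (signVec wOf t₀ δ v))
        (scaleConj (fun j => sqrtAbs (signVec wOf t₀ δ v) j) M) := by
    rw [UnitaryBall.mat, archUFormPi_apply, coe_archUForm, archPart_archToAdelic]
  have h12 : (UnitaryBall.mat (archUFormPi E c N hc wOf hw hover t₀ ht0 hTd hJ hcδ hδ g v)).toBlocks₁₂ = 0 := by
    rw [hmat]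
    ext p q
    rw [Matrix.toBlocks₁₂, Matrix.of_apply, Matrix.reindex_apply, Matrix.submatrix_apply, scaleConj_apply, Matrix.zero_apply]
    have h := (hsep p.1 q.1 p.2 q.2).1
    rw [show (signSplit (signVec wOf t₀ δ v)).symm (Sum.inl p) = p.1 from rfl,
      show (signSplit (signVec wOf t₀ δ v)).symm (Sum.inr q) = q.1 from rfl, h, mul_zero, zero_mul]
  have h21 : (UnitaryBall.mat (archUFormPi E c N hc wOf hw hover t₀ ht0 hTd hJ hcδ hδ g v)).toBlocks₂₁ = 0 := by
    rw [hmat]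
    ext q p
    rw [Matrix.toBlocks₂₁, Matrix.of_apply, Matrix.reindex_apply, Matrix.submatrix_apply, scaleConj_apply, Matrix.zero_apply]
    have h := (hsep p.1 q.1 p.2 q.2).2
    rw [show (signSplit (signVec wOf t₀ δ v)).symm (Sum.inl p) = p.1 from rfl,
      show (signSplit (signVec wOf t₀ δ v)).symm (Sum.inr q) = q.1 from rfl, h, mul_zero, zero_mul]
  obtain ⟨k, hk, hk1, hk2⟩ := UForm.exists_eq_kV_of_toBlocks_eq_zero (archUFormPi E c N hc wOf hw hover t₀ ht0 hTd hJ hcδ hδ g v) h12 h21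
  refine ⟨k, hk, ?_, ?_⟩
  · rw [hk1]
    change (UnitaryBall.mat (archUFormPi E c N hc wOf hw hover t₀ ht0 hTd hJ hcδ hδ g v)).toBlocks₁₁ = _
    rw [hmat]
    ext p p'
    rw [Matrix.toBlocks₁₁, Matrix.of_apply, Matrix.reindex_apply, Matrix.submatrix_apply, scaleConj_apply, scaleConj_apply,
      Matrix.submatrix_apply]
    rfl
  · rw [hk2]
    change (UnitaryBall.mat (archUFormPi E c N hc wOf hw hover t₀ ht0 hTd hJ hcδ hδ g v)).toBlocks₂₂ = _
    rw [hmat]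
    ext q q'
    rw [Matrix.toBlocks₂₂, Matrix.of_apply, Matrix.reindex_apply, Matrix.submatrix_apply, scaleConj_apply, scaleConj_apply,
      Matrix.submatrix_apply]
    rfl

/-- **The determinants of the two blocks** are those of the sign-sorted sub-matrices of `g_{w(v)}` (the adapted scaling is diagonal:
★ `det_scaleConj`) — `det b_v` is the input of Folland's vacuum coefficient `vac = ∏_v (det b_v)⁻¹` (★ `vac_archWeilSectionS_of_kV`).
[cite: Folland1989, §4.2 Prop. (4.39)] -/
theorem det_of_archUFormPi_eq_kV_of_sign_separated (g : UnitaryGroup.arch F E c N J) (v : {v : InfinitePlace F // v.IsReal})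
    (hsep : ∀ i j : Fin N, 0 < signVec wOf t₀ δ v i → ¬ 0 < signVec wOf t₀ δ v j →
      (((archAt F E c N J (wOf v) (hw v) hc g : archLocal E N J (wOf v)) : GL (Fin N) ℂ) : Matrix (Fin N) (Fin N) ℂ) i j = 0 ∧
        (((archAt F E c N J (wOf v) (hw v) hc g : archLocal E N J (wOf v)) : GL (Fin N) ℂ) : Matrix (Fin N) (Fin N) ℂ) j i = 0) :
    ∃ k : Matrix.unitaryGroup (PosIdx (signVec wOf t₀ δ v)) ℂ × Matrix.unitaryGroup (NegIdx (signVec wOf t₀ δ v)) ℂ,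
      archUFormPi E c N hc wOf hw hover t₀ ht0 hTd hJ hcδ hδ g v = UForm.kV _ _ k ∧
        (k.1 : Matrix (PosIdx (signVec wOf t₀ δ v)) (PosIdx (signVec wOf t₀ δ v)) ℂ).det =
          ((((archAt F E c N J (wOf v) (hw v) hc g : archLocal E N J (wOf v)) : GL (Fin N) ℂ) : Matrix (Fin N) (Fin N) ℂ).submatrix
              (fun p : PosIdx (signVec wOf t₀ δ v) => p.1) fun p => p.1).det ∧
        (k.2 : Matrix (NegIdx (signVec wOf t₀ δ v)) (NegIdx (signVec wOf t₀ δ v)) ℂ).det =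
          ((((archAt F E c N J (wOf v) (hw v) hc g : archLocal E N J (wOf v)) : GL (Fin N) ℂ) : Matrix (Fin N) (Fin N) ℂ).submatrix
              (fun q : NegIdx (signVec wOf t₀ δ v) => q.1) fun q => q.1).det := by
  obtain ⟨k, hk, hk1, hk2⟩ := exists_archUFormPi_eq_kV_of_sign_separated E c N hc wOf hw hover t₀ ht0 hTd hJ hcδ hδ g v hsep
  refine ⟨k, hk, ?_, ?_⟩
  · rw [hk1]
    exact det_scaleConj (fun p : PosIdx (signVec wOf t₀ δ v) => sqrtAbs (signVec wOf t₀ δ v) p.1)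
      (fun p => sqrtAbs_signVec_ne_zero hc hw hcδ hδ ht0 v p.1) _
  · rw [hk2]
    exact det_scaleConj (fun q : NegIdx (signVec wOf t₀ δ v) => sqrtAbs (signVec wOf t₀ δ v) q.1)
      (fun q => sqrtAbs_signVec_ne_zero hc hw hcδ hδ ht0 v q.1) _

end Literature.NumberTheory.Weil1964

end
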